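import Mathlib
import Summits.PneNP.PneNP.Theorems.OverlapGapAlgebraNoStableSection
import Summits.PneNP.PneNP.Theorems.OverlapGapAlgebraSearchHardWindowFromCruxes

/-!
# PneNP / OverlapGapAlgebra — `SearchHardWindow` (stmt-PneNP-2460) now follows from
# `SolvableImpliesStableSection` (stmt-PneNP-2463) ALONE

Support for crux `stmt-PneNP-2460` (`Summit.PneNP.PneNP.Theses.OverlapGapAlgebra.SearchHardWindow`).
With `NoStableSection` (stmt-PneNP-2462) closed by `noStableSection_proof` (line `DartGame`), the
two-crux reductions of `OverlapGapAlgebraSearchHardWindowFromCruxes.lean` lose their first hypothesis: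

* `searchHardWindow_of_solvableImpliesStableSection` — `SolvableImpliesStableSection → SearchHardWindow`;
* `pneNP_of_solvableImpliesStableSection` — `SolvableImpliesStableSection → PneNP`;
* `searchHardWindow_of_windowTransfer'` — the WINDOW form of the transfer (∃ k₁ ∀ k ≥ k₁, at
  `α_k = 5·2^k log k / k`) already gives `SearchHardWindow`.
So the open content of item 2460 is exactly item 2463 (indeed only its window form), which inside the
window is `¬PolySolvable(k, α_k)` (`transfer_false_without_polyTime`).
No new definitions; axioms `propext`, `Classical.choice`, `Quot.sound`.
-/

set_option linter.dupNamespace false -- `Summit.PneNP.PneNP.…`: summit = sub-problem (D-0017)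

namespace Summit.PneNP.PneNP.Theorems

open Summit.PneNP.PneNP.Theses.OverlapGapAlgebra

/-- **`SearchHardWindow` from the transfer crux alone**: `NoStableSection` is a theorem
(`noStableSection_proof`), so `searchHardWindow_of_cruxes` needs only `SolvableImpliesStableSection`. -/
theorem searchHardWindow_of_solvableImpliesStableSection (hSolv : SolvableImpliesStableSection) :
    SearchHardWindow :=
  searchHardWindow_of_cruxes noStableSection_proof hSolv

/-- **The summit from the transfer crux alone**: `SolvableImpliesStableSection → PneNP`. -/
theorem pneNP_of_solvableImpliesStableSection (hSolv : SolvableImpliesStableSection) : _root_.PneNP :=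
  pneNP_of_cruxes noStableSection_proof hSolv

/-- **`SearchHardWindow` from the WINDOW form of the transfer alone** (the hypothesis of
`searchHardWindow_of_windowTransfer` minus `NoStableSection`): for all large `k`, at the window density
`α_k = 5·2^k log k/k`, polynomial-time solvability with probability `≥ ε` infinitely often would give,
for all `η, ν, c > 0`, stable sections on `≥ e^{-cn}` of the path tuples infinitely often. -/
theorem searchHardWindow_of_windowTransfer'
    (hT : ∃ k₁ : ℕ, ∀ k : ℕ, k₁ ≤ k → ∀ η ν : ℝ, 0 < η → 0 < ν →
      (∃ f : List Bool → List Bool, Literature.Computability.Complexity.IsPolyTime f ∧ ∃ ε : ℝ, 0 < ε ∧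
        ∃ᶠ n : ℕ in Filter.atTop, ∀ m : ℕ, m = ⌊5 * 2 ^ k * Real.log k / k * n⌋₊ → ε ≤
          ((Finset.univ.filter fun Φ : Fin m → Fin k → Fin n × Bool => ∀ i, ∃ j,
            (f (Literature.Computability.Complexity.encodingCNF.encode (List.ofFn fun a =>
              List.ofFn fun b => (((Φ a b).1 : ℕ), (Φ a b).2)))).getD (Φ i j).1 false =
                (Φ i j).2).card : ℝ) / Fintype.card (Fin m → Fin k → Fin n × Bool)) →
      ∀ c : ℝ, 0 < c → ∃ᶠ n : ℕ in Filter.atTop, ∀ m : ℕ, m = ⌊5 * 2 ^ k * Real.log k / k * n⌋₊ →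
        ∃ g : (Fin m → Fin k → Fin n × Bool) → (Fin n → Bool),
          Real.exp (-(c * n)) * Fintype.card (Fin (k + 1) → Fin m → Fin k → Fin n × Bool) ≤
          ((Finset.univ.filter fun Ψ : Fin (k + 1) → Fin m → Fin k → Fin n × Bool =>
            let P : Fin k → ℕ → Fin m → Fin k → Fin n × Bool :=
              fun r q a b => if (a : ℕ) * k + b < q then Ψ r.succ a b else Ψ r.castSucc a b
            (∀ r : Fin k, ∀ q ≤ m * k, ((Finset.univ.filter fun i : Fin m =>
              ∀ j, g (P r q) (P r q i j).1 ≠ (P r q i j).2).card : ℝ) ≤ ν * m) ∧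
            ∀ r : Fin k, ∀ q < m * k,
              (hammingDist (g (P r q)) (g (P r (q + 1))) : ℝ) ≤ η * n).card : ℝ)) :
    SearchHardWindow :=
  searchHardWindow_of_windowTransfer noStableSection_proof hT

end Summit.PneNP.PneNP.Theorems
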